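import Mathlib
import Summits.NavierStokesRegularity.NavierStokesRegularity.Theorems.SubOnsagerCeilingVirtualFloorChainCoupledFace
import Summits.NavierStokesRegularity.NavierStokesRegularity.Theorems.SubOnsagerCeilingGapBridge
import Summits.NavierStokesRegularity.NavierStokesRegularity.Theorems.SubOnsagerCeilingGapCertASmall
import Summits.NavierStokesRegularity.NavierStokesRegularity.Theorems.SubOnsagerCeilingGapCertABulk
import Summits.NavierStokesRegularity.NavierStokesRegularity.Theorems.SubOnsagerCeilingGapCertADamp
import Summits.NavierStokesRegularity.NavierStokesRegularity.Theorems.SubOnsagerCeilingGapCertACarve1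
import Summits.NavierStokesRegularity.NavierStokesRegularity.Theorems.SubOnsagerCeilingGapCertACarve2
import Summits.NavierStokesRegularity.NavierStokesRegularity.Theorems.SubOnsagerCeilingGapCertACarve3
import Summits.NavierStokesRegularity.NavierStokesRegularity.Theorems.SubOnsagerCeilingGapCertACarve4
import Summits.NavierStokesRegularity.NavierStokesRegularity.Theorems.SubOnsagerCeilingGapCertACarve5
import HarnessLib

/-!
# RUNG 10, slice A: the chain barrier `θ = 101/200` at every `b ∈ [3/2, 38/25]` from the d45 certificates
(helper file for crux stmt-NavierStokesRegularity-27057 `SubOnsagerCeiling.ForwardTailCeilingKP`, `--supports … --as helper`;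
LEAD SOC g11, line «kp-shell-barrier»)

Assembly for the slice `b ∈ [3/2, 38/25]` of the gap below `b = 25/16`: (i) the rescaling constants `L = b^(5/2)/b^(101/200) = b^(399/200)`,
`p = b^(5/2)/(b^(101/200))³ = b^(197/200)`, `b²` lie in the rational box of the slice's certificates (`sliceA_consts`, by comparing
`200`-th powers); (ii) the `hFace` hypothesis of `VirtualFloor.chain_le_of_coupledFaceCertB` (p689309) for the face family «d45»
(`SubOnsagerCeilingGapFaces`) at every such `b`, from the kernel certificates `cert_A_*` (files `SubOnsagerCeilingGapCertA*`) through
the bridge `inertial_of_cert` / `damping_of_cert` (`SubOnsagerCeilingGapBridge`), the carve floor's inertial condition by the kd case split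
of its 5 certificate parts (`Box.mem_split`), the structural damping signs by `face_damping_easy`; (iii) the chain barrier
`(b^(101/200))^(2k) Z_k(t)² ≤ 100 x₀²` along every honest non-negative `ν`-viscous Katz–Pavlović chain from a one-shell datum
(`gap_chain_A`). HONEST FRAMING: MODEL lattice (route SubOnsagerCeiling, TL-M2Break); nothing here bears on Navier–Stokes regularity;
27057 stays OPEN. [cite: BarbatoMorandinRomito2011, §2 Lemma 2.1, §3.2] [cite: Tao2016AveragedNS, §4 (4.5), (4.13)]
-/

noncomputable section

-- the sub-problem namespace `NavierStokesRegularity.NavierStokesRegularity` is the tree's layout (D-0017)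
set_option linter.dupNamespace false

namespace Summit.NavierStokesRegularity.NavierStokesRegularity.Theorems.VirtualFloor.GapRung

open Set Filter Topology
open Literature.Analysis.ValidatedNumerics KernelFaceMul KernelFaceAffine
open Summit.NavierStokesRegularity.NavierStokesRegularity.Theorems.VirtualFloor

/-! ## Numerical facts: the rescaling constants of the slice lie in the certificates' box -/

/-- `7017/3125 ≤ (3/2)^(399/200)`. [folklore] -/
theorem sliceA_L_lo : ((7017 / 3125 : ℚ) : ℝ) ≤ (3 / 2 : ℝ) ^ ((399 : ℝ) / 200) := by
  have h0 : (0 : ℝ) ≤ (3 / 2 : ℝ) ^ ((399 : ℝ) / 200) := by positivity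
  have h2 : ((3 / 2 : ℝ) ^ ((399 : ℝ) / 200)) ^ (200 : ℕ) = (3 / 2 : ℝ) ^ (399 : ℕ) := by
    rw [← Real.rpow_natCast, ← Real.rpow_mul (by norm_num)]
    norm_num
  have hq : ¬ ((3 / 2 : ℚ) ^ (399 : ℕ) < (7017 / 3125 : ℚ) ^ (200 : ℕ)) := by decide +kernel
  have hr : ¬ ((((3 / 2 : ℚ) ^ (399 : ℕ) : ℚ) : ℝ) < (((7017 / 3125 : ℚ) ^ (200 : ℕ) : ℚ) : ℝ)) := by
    rw [Rat.cast_lt]; exact hq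
  push_cast at hr
  push_cast
  by_contra h
  push Not at h
  have h3 : ((3 / 2 : ℝ) ^ ((399 : ℝ) / 200)) ^ (200 : ℕ) < (7017 / 3125 : ℝ) ^ (200 : ℕ) :=
    pow_lt_pow_left₀ h h0 (by norm_num)
  rw [h2] at h3
  exact hr h3

/-- `(38/25)^(399/200) ≤ 230557/100000`. [folklore] -/
theorem sliceA_L_hi : (38 / 25 : ℝ) ^ ((399 : ℝ) / 200) ≤ ((230557 / 100000 : ℚ) : ℝ) := by
  have h0 : (0 : ℝ) ≤ (38 / 25 : ℝ) ^ ((399 : ℝ) / 200) := by positivity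
  have h2 : ((38 / 25 : ℝ) ^ ((399 : ℝ) / 200)) ^ (200 : ℕ) = (38 / 25 : ℝ) ^ (399 : ℕ) := by
    rw [← Real.rpow_natCast, ← Real.rpow_mul (by norm_num)]
    norm_num
  have hq : ¬ ((230557 / 100000 : ℚ) ^ (200 : ℕ) < (38 / 25 : ℚ) ^ (399 : ℕ)) := by decide +kernel
  have hr : ¬ ((((230557 / 100000 : ℚ) ^ (200 : ℕ) : ℚ) : ℝ) < (((38 / 25 : ℚ) ^ (399 : ℕ) : ℚ) : ℝ)) := by
    rw [Rat.cast_lt]; exact hq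
  push_cast at hr
  push_cast
  by_contra h
  push Not at h
  have h3 : (230557 / 100000 : ℝ) ^ (200 : ℕ) < ((38 / 25 : ℝ) ^ ((399 : ℝ) / 200)) ^ (200 : ℕ) :=
    pow_lt_pow_left₀ h (by norm_num) (by norm_num)
  rw [h2] at h3
  exact hr h3

/-- `14909/10000 ≤ (3/2)^(197/200)`. [folklore] -/
theorem sliceA_p_lo : ((14909 / 10000 : ℚ) : ℝ) ≤ (3 / 2 : ℝ) ^ ((197 : ℝ) / 200) := by
  have h0 : (0 : ℝ) ≤ (3 / 2 : ℝ) ^ ((197 : ℝ) / 200) := by positivity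
  have h2 : ((3 / 2 : ℝ) ^ ((197 : ℝ) / 200)) ^ (200 : ℕ) = (3 / 2 : ℝ) ^ (197 : ℕ) := by
    rw [← Real.rpow_natCast, ← Real.rpow_mul (by norm_num)]
    norm_num
  have hq : ¬ ((3 / 2 : ℚ) ^ (197 : ℕ) < (14909 / 10000 : ℚ) ^ (200 : ℕ)) := by decide +kernel
  have hr : ¬ ((((3 / 2 : ℚ) ^ (197 : ℕ) : ℚ) : ℝ) < (((14909 / 10000 : ℚ) ^ (200 : ℕ) : ℚ) : ℝ)) := by
    rw [Rat.cast_lt]; exact hq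
  push_cast at hr
  push_cast
  by_contra h
  push Not at h
  have h3 : ((3 / 2 : ℝ) ^ ((197 : ℝ) / 200)) ^ (200 : ℕ) < (14909 / 10000 : ℝ) ^ (200 : ℕ) :=
    pow_lt_pow_left₀ h h0 (by norm_num)
  rw [h2] at h3
  exact hr h3

/-- `(38/25)^(197/200) ≤ 151049/100000`. [folklore] -/
theorem sliceA_p_hi : (38 / 25 : ℝ) ^ ((197 : ℝ) / 200) ≤ ((151049 / 100000 : ℚ) : ℝ) := by
  have h0 : (0 : ℝ) ≤ (38 / 25 : ℝ) ^ ((197 : ℝ) / 200) := by positivity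
  have h2 : ((38 / 25 : ℝ) ^ ((197 : ℝ) / 200)) ^ (200 : ℕ) = (38 / 25 : ℝ) ^ (197 : ℕ) := by
    rw [← Real.rpow_natCast, ← Real.rpow_mul (by norm_num)]
    norm_num
  have hq : ¬ ((151049 / 100000 : ℚ) ^ (200 : ℕ) < (38 / 25 : ℚ) ^ (197 : ℕ)) := by decide +kernel
  have hr : ¬ ((((151049 / 100000 : ℚ) ^ (200 : ℕ) : ℚ) : ℝ) < (((38 / 25 : ℚ) ^ (197 : ℕ) : ℚ) : ℝ)) := by
    rw [Rat.cast_lt]; exact hq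
  push_cast at hr
  push_cast
  by_contra h
  push Not at h
  have h3 : (151049 / 100000 : ℝ) ^ (200 : ℕ) < ((38 / 25 : ℝ) ^ ((197 : ℝ) / 200)) ^ (200 : ℕ) :=
    pow_lt_pow_left₀ h (by norm_num) (by norm_num)
  rw [h2] at h3
  exact hr h3

/-- The rescaling constants at `b ∈ [3/2, 38/25]` lie in the slice box: `L = b^(399/200) ∈ [7017/3125, 230557/100000]`,
`p = b^(197/200) ∈ [14909/10000, 151049/100000]`, `b² ∈ [9/4, 1444/625]`. [folklore] -/
theorem sliceA_consts {b : ℝ} (hb : (3 / 2 : ℝ) ≤ b) (hb' : b ≤ (38 / 25 : ℝ)) :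
    (((7017 / 3125 : ℚ) : ℝ) ≤ (b ^ ((5 : ℝ) / 2) / b ^ ((101 : ℝ) / 200)) ∧ (b ^ ((5 : ℝ) / 2) / b ^ ((101 : ℝ) / 200)) ≤ ((230557 / 100000 : ℚ) : ℝ)) ∧
    (((14909 / 10000 : ℚ) : ℝ) ≤ (b ^ ((5 : ℝ) / 2) / (b ^ ((101 : ℝ) / 200)) ^ 3) ∧ (b ^ ((5 : ℝ) / 2) / (b ^ ((101 : ℝ) / 200)) ^ 3) ≤ ((151049 / 100000 : ℚ) : ℝ)) ∧
    (((9 / 4 : ℚ) : ℝ) ≤ b ^ 2 ∧ b ^ 2 ≤ ((1444 / 625 : ℚ) : ℝ)) := by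
  have hb0 : 0 < b := by linarith
  have hL : (b ^ ((5 : ℝ) / 2) / b ^ ((101 : ℝ) / 200)) = b ^ ((399 : ℝ) / 200) := by
    rw [← Real.rpow_sub hb0]; norm_num
  have hp : (b ^ ((5 : ℝ) / 2) / (b ^ ((101 : ℝ) / 200)) ^ 3) = b ^ ((197 : ℝ) / 200) := by
    rw [← Real.rpow_natCast, ← Real.rpow_mul hb0.le, ← Real.rpow_sub hb0]; norm_num
  rw [hL, hp]
  refine ⟨⟨sliceA_L_lo.trans (Real.rpow_le_rpow (by norm_num) hb (by norm_num)),
    (Real.rpow_le_rpow hb0.le hb' (by norm_num)).trans sliceA_L_hi⟩,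
    ⟨sliceA_p_lo.trans (Real.rpow_le_rpow (by norm_num) hb (by norm_num)),
    (Real.rpow_le_rpow hb0.le hb' (by norm_num)).trans sliceA_p_hi⟩, ?_, ?_⟩
  · push_cast; nlinarith
  · push_cast; nlinarith

/-! ## The `hFace` hypothesis at every `b` of the slice -/

/-- **`hFace` for the family «d45» at every `b ∈ [3/2, 38/25]`**: on each active face, the strict inertial inequality along the
coupled field and the damping sign condition (kernel certificates + bridge + structural damping). [cite: BarbatoMorandinRomito2011, §2 Lemma 2.1] -/
theorem sliceA_hFace {b : ℝ} (hb : (3 / 2 : ℝ) ≤ b) (hb' : b ≤ (38 / 25 : ℝ)) :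
    ∀ k (x : Fin 4 → ℝ) (v z : ℝ), (∀ i, 0 ≤ x i) → 0 ≤ v → 0 ≤ z → (∀ i, x i ≤ (49 / 50 : ℝ)) → v ≤ (49 / 50 : ℝ) →
      z ≤ (49 / 50 : ℝ) → (∀ k', face k' x ≤ 0) → (∀ k', face k' (vec4 v (x 0) (x 1) (x 2)) ≤ 0) →
      (∀ k', face k' (vec4 (x 1) (x 2) (x 3) z) ≤ 0) → face k x = 0 →
      (faceGrad k 0 x * (v ^ 2 - (b ^ ((5 : ℝ) / 2) / (b ^ ((101 : ℝ) / 200)) ^ 3) * x 0 * x 1) +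
          faceGrad k 1 x * ((b ^ ((5 : ℝ) / 2) / b ^ ((101 : ℝ) / 200)) * (x 0 ^ 2 - (b ^ ((5 : ℝ) / 2) / (b ^ ((101 : ℝ) / 200)) ^ 3) * x 1 * x 2)) +
          faceGrad k 2 x * ((b ^ ((5 : ℝ) / 2) / b ^ ((101 : ℝ) / 200)) ^ 2 * (x 1 ^ 2 - (b ^ ((5 : ℝ) / 2) / (b ^ ((101 : ℝ) / 200)) ^ 3) * x 2 * x 3)) +
          faceGrad k 3 x * ((b ^ ((5 : ℝ) / 2) / b ^ ((101 : ℝ) / 200)) ^ 3 * (x 2 ^ 2 - (b ^ ((5 : ℝ) / 2) / (b ^ ((101 : ℝ) / 200)) ^ 3) * x 3 * z)) < 0) ∧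
      0 ≤ faceGrad k 0 x * x 0 + faceGrad k 1 x * ((b ^ 2) * x 1) + faceGrad k 2 x * ((b ^ 2) ^ 2 * x 2) +
        faceGrad k 3 x * ((b ^ 2) ^ 3 * x 3) := by
  intro k x v z h0 hv0 hz0 hc hvc hzc hX hLo hUp hk
  obtain ⟨hL, hp, hb2⟩ := sliceA_consts hb hb'
  have hmem := pt_mem_box9 h0 hc hv0 hvc hz0 hzc hL hp hb2
  refine ⟨inertial_real_of_eval (b2 := b ^ 2) ?_, ?_⟩
  · cases k
    · exact inertial_of_cert cert_A_cap1 hmem h0 hc hX hLo hUp hk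
    · exact inertial_of_cert cert_A_cap2 hmem h0 hc hX hLo hUp hk
    · exact inertial_of_cert cert_A_cap3 hmem h0 hc hX hLo hUp hk
    · exact inertial_of_cert cert_A_cub0 hmem h0 hc hX hLo hUp hk
    · exact inertial_of_cert cert_A_cub1 hmem h0 hc hX hLo hUp hk
    · exact inertial_of_cert cert_A_cub2 hmem h0 hc hX hLo hUp hk
    · exact inertial_of_cert cert_A_capA hmem h0 hc hX hLo hUp hk
    · exact inertial_of_cert cert_A_capB hmem h0 hc hX hLo hUp hk
    · exact inertial_of_cert cert_A_bulk hmem h0 hc hX hLo hUp hk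
    · rcases Box.mem_split hmem 2 (49/100) with hmem' | hmem'
      · exact inertial_of_cert cert_A_carve_1 hmem' h0 hc hX hLo hUp hk
      · rcases Box.mem_split hmem' 2 (147/200) with hmem'' | hmem''
        · exact inertial_of_cert cert_A_carve_2 hmem'' h0 hc hX hLo hUp hk
        · rcases Box.mem_split hmem'' 2 (343/400) with hmem''' | hmem'''
          · rcases Box.mem_split hmem''' 5 (49/100) with hmem'''' | hmem''''
            · exact inertial_of_cert cert_A_carve_3 hmem'''' h0 hc hX hLo hUp hk
            · exact inertial_of_cert cert_A_carve_4 hmem'''' h0 hc hX hLo hUp hk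
          · exact inertial_of_cert cert_A_carve_5 hmem''' h0 hc hX hLo hUp hk
  · have hB20 : (0 : ℝ) ≤ b ^ 2 := by positivity
    have hB23 : b ^ 2 ≤ 3 := by nlinarith
    cases k
    · exact face_damping_easy x (b ^ 2) h0 hB20 hB23 .cap1 (by decide) (by decide) hk
    · exact face_damping_easy x (b ^ 2) h0 hB20 hB23 .cap2 (by decide) (by decide) hk
    · exact face_damping_easy x (b ^ 2) h0 hB20 hB23 .cap3 (by decide) (by decide) hk
    · exact face_damping_easy x (b ^ 2) h0 hB20 hB23 .cub0 (by decide) (by decide) hk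
    · exact face_damping_easy x (b ^ 2) h0 hB20 hB23 .cub1 (by decide) (by decide) hk
    · exact face_damping_easy x (b ^ 2) h0 hB20 hB23 .cub2 (by decide) (by decide) hk
    · exact face_damping_easy x (b ^ 2) h0 hB20 hB23 .capA (by decide) (by decide) hk
    · exact face_damping_easy x (b ^ 2) h0 hB20 hB23 .capB (by decide) (by decide) hk
    · exact damping_of_cert cert_A_bulk_damp hmem h0 hc hX hLo hUp hk
    · exact damping_of_cert cert_A_carve_damp hmem h0 hc hX hLo hUp hk

/-! ## The chain barrier on the slice -/

/-- **The ν-uniform chain barrier `θ = 101/200` at every `b ∈ [3/2, 38/25]`**: along every honest non-negative `ν`-viscous solution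
of the Katz–Pavlović chain (couplings `c₀ b^(5k/2)`, damping `ν b^(2k)`) from the one-shell datum `x₀`,
`(b^(101/200))^(2k) Z_k(t)² ≤ 100 x₀²`. Via `chain_le_of_coupledFaceCertB` with the family «d45».
[cite: BarbatoMorandinRomito2011, §3.2 (the rescaling)] [cite: Tao2016AveragedNS, §4 (4.5), (4.13)] -/
theorem gap_chain_A {b c₀ ν s x₀ : ℝ} (hb : (3 / 2 : ℝ) ≤ b) (hb' : b ≤ (38 / 25 : ℝ)) (hc₀ : 0 < c₀)
    (hν : 0 < ν) (hs : 0 < s) {Z : ℤ → ℝ → ℝ}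
    (hdat : ∀ k : ℤ, Z k 0 = if k = 0 then x₀ else 0)
    (hvan : ∀ t, Z (-1) t = 0)
    (hbdd : ∃ M : ℝ, ∀ (t : ℝ) (k : ℕ), (1 + b ^ ((10 : ℝ) * k)) * |Z k t| ≤ M)
    (hcont : ∀ k : ℕ, ContinuousOn (Z k) (Icc 0 s))
    (hode : ∀ k : ℕ, ∀ t ∈ Icc 0 s, HasDerivWithinAt (Z k)
      (c₀ * (b ^ ((5 : ℝ) * ((k : ℝ) - 1) / 2) * Z ((k : ℤ) - 1) t ^ 2 -
          b ^ ((5 : ℝ) * (k : ℝ) / 2) * (Z k t * Z ((k : ℤ) + 1) t)) -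
        ν * b ^ ((2 : ℝ) * (k : ℝ)) * Z k t) (Icc 0 s) t)
    (hnn : ∀ t ∈ Icc 0 s, ∀ k : ℕ, 1 ≤ k → 0 ≤ Z k t) :
    ∀ t ∈ Icc 0 s, ∀ k : ℕ, (b ^ ((101 : ℝ) / 200)) ^ (2 * k) * Z k t ^ 2 ≤ 100 * x₀ ^ 2 :=
  chain_le_of_coupledFaceCertB (by linarith) (by linarith) hc₀ (by norm_num : (49 / 50 : ℝ) ≤ 1) hν hs
    face_continuous face_hasDerivWithinAt face_init face_safe (sliceA_hFace hb hb') hdat hvan hbdd hcont hode hnn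

end Summit.NavierStokesRegularity.NavierStokesRegularity.Theorems.VirtualFloor.GapRung

end
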